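import Mathlib
import Summits.NavierStokesRegularity.NavierStokesRegularity.Theorems.EulerZoomLiouvillePowerGaugeEulerLiouvilleNeedleFeedingLabels
import HarnessLib

/-!
# Crux `EulerZoomLiouville.PowerGaugeEulerLiouville` (stmt-NavierStokesRegularity-19832): tools for THE MEAN STRAIN LAW (plate t59-MS of nsreg-p2 ROUND-54 «THE TRACE»)

Width/portrait helper for THE ONE STATEMENT `stub_selfSimilarC2Needle` (LEAD skeleton `Cruxes/PowerGaugeEulerLiouville/Lines/birth.lean`
v111, ns-typeII-p2 g16), `--supports stmt-NavierStokesRegularity-19832 --as helper`.  Text custody nsreg-p2 g44 (`r54/Sketch54.lean`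
sha16 f78682d2f4ee3f27, `NsregP2.R54.Trace.MeanStrainLaw`); this file carries the three ingredients of its proof, in the lineage's cut-off
idiom (a `C²` field `V′` with `‖DV′‖ ≤ K`, flow `Ψ_s = ODE.evolutionMap (fun _ => selfSimilarTransport γ 0 V′) 0 s`):

* `measurableSet_forwardStayProd` — the forward stay set `{(y, σ) : ∀ σ″ ∈ [0,σ], ‖Ψ_{σ″} y‖ ≤ f σ″}` (continuous radius profile `f`)
  is measurable in `(y, σ)` (rational times + continuity of the orbit, as in `NeedleFeeding.measurableSet_stayTube`);
* `lintegral_comp_flow_section_eq` — **the area formula with the constant Jacobian** `e^{3γσ}` on labels whose orbit stays where `V′` is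
  divergence-free: `e^{3γσ} ∫_F g(Ψ_σ y) dy = ∫_{Ψ_σ F} g` (`BernoulliLandscape.det_fderiv_flow_eq_exp_of_stay`,
  `lintegral_image_eq_lintegral_abs_det_fderiv_mul`);
* `lintegral_closedBall_enorm_le_of_weightedBudget` — **the strain budget on balls**: for `ρ ≤ 1`, `R ≥ 1`,
  `∫_{B̄_R} ‖DV‖ ≤ |B̄_R|^{1/2} (R^{1−ρ} E)^{1/2}`, `E = ∫ ‖DV(y)‖² ‖y‖^{ρ−1} dy` (Cauchy–Schwarz and `‖y‖^{ρ−1} ≥ R^{ρ−1}` on `B̄_R`);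
* `strain_bookkeeping` — the exponent identity behind `γ(1 + ρ/2) = ½`:
  `√(R_σ³ v)·√(R_σ^{1−ρ} e)·e^{−3γσ} = √(v e)(CL)^{2−ρ/2} e^{−σ/2}`, `R_σ = CL e^{γσ}`, `γ = 1/(2+ρ)`.

HONEST FRAMING: bookkeeping about HYPOTHETICAL profiles / smooth cut-off fields; nothing about the crux E (19832 OPEN) or NS regularity
is proved here. [nsreg-p2 R54 §C t59-MS; cite: ConstantinIgnatovaVicol2026Putative, §3.4.1 eq. (3.21)–(3.22)]
-/

noncomputable section

set_option linter.dupNamespace false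

open MeasureTheory Set Filter Topology Metric Function
open scoped RealInnerProductSpace NNReal ENNReal ContDiff

namespace Summit.NavierStokesRegularity.NavierStokesRegularity.Theorems.PowerGaugeEulerLiouville.Trace

open Literature.Analysis Literature.Analysis.FluidPDE
open Summit.NavierStokesRegularity.NavierStokesRegularity.Theorems.PowerGaugeEulerLiouville.BernoulliLandscape
open Summit.NavierStokesRegularity.NavierStokesRegularity.Theorems.PowerGaugeEulerLiouville.NeedleFeeding

variable {γ : ℝ} {V : EuclideanSpace ℝ (Fin 3) → EuclideanSpace ℝ (Fin 3)} {K : ℝ}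

/-! ### Measurability of the forward stay set in `(label, time)` -/

/-- **The forward stay set is measurable in `(y, σ)`**: for a continuous radius profile `f`,
`{(y, σ) : ∀ σ″ ∈ [0, σ], ‖Ψ_{σ″} y‖ ≤ f σ″}` is tested at rational times plus the endpoint (continuity of the orbit).
[cite: ConstantinIgnatovaVicol2026Putative, §3.4.1 eq. (3.21)] -/
theorem measurableSet_forwardStayProd (hV : ContDiff ℝ 2 V) (hK : ∀ y, ‖fderiv ℝ V y‖ ≤ K) {f : ℝ → ℝ}
    (hf : Continuous f) :
    MeasurableSet {p : EuclideanSpace ℝ (Fin 3) × ℝ |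
      ∀ σ ∈ Icc 0 p.2, ‖ODE.evolutionMap (fun _ : ℝ => selfSimilarTransport γ 0 V) 0 σ p.1‖ ≤ f σ} := by
  have hΘ : Continuous fun p : EuclideanSpace ℝ (Fin 3) × ℝ =>
      ODE.evolutionMap (fun _ : ℝ => selfSimilarTransport γ 0 V) 0 p.2 p.1 :=
    (continuous_flow_uncurry (γ := γ) hV hK).comp (continuous_snd.prodMk continuous_fst)
  have heq : {p : EuclideanSpace ℝ (Fin 3) × ℝ |
      ∀ σ ∈ Icc 0 p.2, ‖ODE.evolutionMap (fun _ : ℝ => selfSimilarTransport γ 0 V) 0 σ p.1‖ ≤ f σ} =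
      (⋂ q : ℚ, ({p : EuclideanSpace ℝ (Fin 3) × ℝ | (q : ℝ) < 0} ∪ {p | p.2 < q} ∪
        {p | ‖ODE.evolutionMap (fun _ : ℝ => selfSimilarTransport γ 0 V) 0 (q : ℝ) p.1‖ ≤ f q})) ∩
      ({p : EuclideanSpace ℝ (Fin 3) × ℝ | p.2 < 0} ∪
        {p | ‖ODE.evolutionMap (fun _ : ℝ => selfSimilarTransport γ 0 V) 0 p.2 p.1‖ ≤ f p.2}) := by
    ext p
    simp only [mem_inter_iff, mem_iInter, mem_union, mem_setOf_eq]
    constructor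
    · intro hst
      refine ⟨fun q => ?_, ?_⟩
      · by_cases h1 : (q : ℝ) < 0
        · exact Or.inl (Or.inl h1)
        · by_cases h2 : p.2 < q
          · exact Or.inl (Or.inr h2)
          · exact Or.inr (hst q ⟨not_lt.1 h1, not_lt.1 h2⟩)
      · by_cases h0 : p.2 < 0
        · exact Or.inl h0
        · exact Or.inr (hst p.2 ⟨not_lt.1 h0, le_rfl⟩)
    · rintro ⟨hQ', hC'⟩ σ hσ
      rcases eq_or_lt_of_le hσ.2 with hσeq | hσlt
      · rcases hC' with h0 | h
        · exact absurd (hσ.1.trans hσ.2) (not_le.2 h0)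
        · rw [hσeq]; exact h
      · -- `σ < p.2`: continuity through rational times in `(σ, p.2)`
        by_contra hgt
        push Not at hgt
        have hcont : Continuous fun τ : ℝ =>
            ‖ODE.evolutionMap (fun _ : ℝ => selfSimilarTransport γ 0 V) 0 τ p.1‖ - f τ :=
          (continuous_flow_time (γ := γ) hV hK p.1).norm.sub hf
        have hgt' : 0 < ‖ODE.evolutionMap (fun _ : ℝ => selfSimilarTransport γ 0 V) 0 σ p.1‖ - f σ := sub_pos.2 hgt
        obtain ⟨ε, hε, hball⟩ :=
          Metric.eventually_nhds_iff.1 (hcont.continuousAt.eventually (lt_mem_nhds hgt'))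
        obtain ⟨q, hq1, hq2⟩ := exists_rat_btwn (lt_min hσlt (lt_add_of_pos_right σ hε))
        have hqσ : σ < q := hq1
        have hq_ball : dist (q : ℝ) σ < ε := by
          rw [Real.dist_eq, abs_of_pos (sub_pos.2 hqσ)]
          linarith [hq2.trans_le (min_le_right _ _)]
        rcases hQ' q with (h | h) | h
        · exact absurd (hσ.1.trans_lt hqσ) (not_lt.2 h.le)
        · exact absurd (hq2.trans_le (min_le_left _ _)) (not_lt.2 h.le)
        · exact absurd (sub_pos.1 (hball hq_ball)) (not_lt.2 h)
  rw [heq]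
  refine (MeasurableSet.iInter fun q => ?_).inter
    ((measurableSet_lt measurable_snd measurable_const).union
      (measurableSet_le hΘ.norm.measurable (hf.measurable.comp measurable_snd)))
  refine (MeasurableSet.union ?_ (measurableSet_lt measurable_snd measurable_const)).union
    (measurableSet_le ((continuous_flow_uncurry (γ := γ) hV hK).comp
      (continuous_const.prodMk continuous_fst)).norm.measurable measurable_const)
  by_cases h : (q : ℝ) < 0
  · simp only [h, setOf_true]; exact MeasurableSet.univ
  · simp only [h, setOf_false]; exact MeasurableSet.empty

/-- The forward stay set at a fixed time, `{y : ∀ σ″ ∈ [0,σ], ‖Ψ_{σ″} y‖ ≤ f σ″}`, is closed. [folklore] -/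
theorem isClosed_forwardStay_fun (hV : ContDiff ℝ 2 V) (hK : ∀ y, ‖fderiv ℝ V y‖ ≤ K) (σ : ℝ) (f : ℝ → ℝ) :
    IsClosed {y : EuclideanSpace ℝ (Fin 3) |
      ∀ σ' ∈ Icc 0 σ, ‖ODE.evolutionMap (fun _ : ℝ => selfSimilarTransport γ 0 V) 0 σ' y‖ ≤ f σ'} := by
  have heq : {y : EuclideanSpace ℝ (Fin 3) |
      ∀ σ' ∈ Icc 0 σ, ‖ODE.evolutionMap (fun _ : ℝ => selfSimilarTransport γ 0 V) 0 σ' y‖ ≤ f σ'} =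
      ⋂ σ' ∈ Icc (0 : ℝ) σ, {y | ‖ODE.evolutionMap (fun _ : ℝ => selfSimilarTransport γ 0 V) 0 σ' y‖ ≤ f σ'} := by
    ext y; simp only [mem_setOf_eq, mem_iInter]
  rw [heq]
  exact isClosed_biInter fun σ' _ =>
    isClosed_le ((C2.Kelvin.contDiff_flow (γ := γ) hV hK σ').continuous.norm) continuous_const

/-! ### The area formula with the constant Jacobian on staying labels -/

/-- **Area formula on staying labels.**  If `V` is divergence-free on `‖z‖ ≤ R` and every orbit from the measurable label set `F`
stays in that ball on `[0, σ]` (`σ ≥ 0`), then `e^{3γσ} ∫_F g(Ψ_σ y) dy = ∫_{Ψ_σ F} g` for every measurable `g ≥ 0`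
(`det DΨ_σ = e^{3γσ}` on `F`, `Ψ_σ` injective). [cite: ConstantinIgnatovaVicol2026Putative, §3.4.1 eq. (3.22) (remark after)] -/
theorem lintegral_comp_flow_section_eq (hV : ContDiff ℝ 2 V) (hK : ∀ y, ‖fderiv ℝ V y‖ ≤ K) {R σ : ℝ} (hσ : 0 ≤ σ)
    (hdiv : ∀ z : EuclideanSpace ℝ (Fin 3), ‖z‖ ≤ R → VectorCalculus.divergence V z = 0)
    {F : Set (EuclideanSpace ℝ (Fin 3))} (hFm : MeasurableSet F)
    (hstay : ∀ y ∈ F, ∀ σ' ∈ Icc 0 σ, ‖ODE.evolutionMap (fun _ : ℝ => selfSimilarTransport γ 0 V) 0 σ' y‖ ≤ R)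
    {g : EuclideanSpace ℝ (Fin 3) → ℝ≥0∞} (hg : Measurable g) :
    ENNReal.ofReal (Real.exp (3 * γ * σ)) *
        ∫⁻ y in F, g (ODE.evolutionMap (fun _ : ℝ => selfSimilarTransport γ 0 V) 0 σ y) =
      ∫⁻ z in ODE.evolutionMap (fun _ : ℝ => selfSimilarTransport γ 0 V) 0 σ '' F, g z := by
  have hV1 : ContDiff ℝ 1 V := hV.of_le (by norm_num)
  have hdiff : ∀ x ∈ F, HasFDerivWithinAt (ODE.evolutionMap (fun _ : ℝ => selfSimilarTransport γ 0 V) 0 σ)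
      (fderiv ℝ (ODE.evolutionMap (fun _ : ℝ => selfSimilarTransport γ 0 V) 0 σ) x) F x := fun x _ =>
    (((C2.Kelvin.contDiff_flow (γ := γ) hV hK σ).differentiable (by norm_num)) x).hasFDerivAt.hasFDerivWithinAt
  have hinj : InjOn (ODE.evolutionMap (fun _ : ℝ => selfSimilarTransport γ 0 V) 0 σ) F :=
    ((C2.Kelvin.isUniformlyLipschitzOn_transport (γ := γ) hV1 hK).bijective_evolutionMap convex_univ
      (mem_univ _) (mem_univ _)).injective.injOn
  have hgm : Measurable fun y => g (ODE.evolutionMap (fun _ : ℝ => selfSimilarTransport γ 0 V) 0 σ y) :=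
    hg.comp (C2.Kelvin.contDiff_flow (γ := γ) hV hK σ).continuous.measurable
  rw [lintegral_image_eq_lintegral_abs_det_fderiv_mul volume hFm hdiff hinj g, ← lintegral_const_mul _ hgm]
  refine setLIntegral_congr_fun hFm (fun z hz => ?_)
  rw [det_fderiv_flow_eq_exp_of_stay (γ := γ) hV hK hσ hdiv z (hstay z hz), abs_of_pos (Real.exp_pos _)]

/-! ### The strain budget on balls -/

/-- **Weighted budget ⇒ budget on balls**: for `ρ ≤ 1` and `R ≥ 1`, `∫_{B̄_R} g² ≤ R^{1−ρ} ∫ g(y)² ‖y‖^{ρ−1} dy`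
(`‖y‖^{ρ−1} ≥ R^{ρ−1}` on `B̄_R ∖ {0}`, and `{0}` is null). [folklore] -/
theorem setLIntegral_closedBall_sq_le_of_weight {ρ R : ℝ} (hρ1 : ρ ≤ 1) (hR : 1 ≤ R)
    (g : EuclideanSpace ℝ (Fin 3) → ℝ≥0∞) :
    ∫⁻ z in closedBall (0 : EuclideanSpace ℝ (Fin 3)) R, g z ^ 2 ≤
      ENNReal.ofReal (R ^ (1 - ρ)) * ∫⁻ z, g z ^ 2 * ENNReal.ofReal (‖z‖ ^ (ρ - 1)) := by
  have hR0 : 0 < R := by linarith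
  have hae : ∀ᵐ z ∂(volume.restrict (closedBall (0 : EuclideanSpace ℝ (Fin 3)) R)),
      g z ^ 2 ≤ ENNReal.ofReal (R ^ (1 - ρ)) * (g z ^ 2 * ENNReal.ofReal (‖z‖ ^ (ρ - 1))) := by
    have h0 : ∀ᵐ z ∂(volume : Measure (EuclideanSpace ℝ (Fin 3))), z ≠ 0 := by
      rw [ae_iff]
      have e : {z : EuclideanSpace ℝ (Fin 3) | ¬ z ≠ 0} = {0} := by ext z; simp
      rw [e, measure_singleton]
    have hmem : ∀ᵐ z ∂(volume.restrict (closedBall (0 : EuclideanSpace ℝ (Fin 3)) R)),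
        z ∈ closedBall (0 : EuclideanSpace ℝ (Fin 3)) R := ae_restrict_mem measurableSet_closedBall
    filter_upwards [ae_restrict_of_ae h0, hmem] with z hz hzR
    rw [mem_closedBall, dist_zero_right] at hzR
    have hzpos : 0 < ‖z‖ := norm_pos_iff.2 hz
    have hw : 1 ≤ R ^ (1 - ρ) * ‖z‖ ^ (ρ - 1) := by
      have h1 : R ^ (ρ - 1) ≤ ‖z‖ ^ (ρ - 1) := Real.rpow_le_rpow_of_nonpos hzpos hzR (by linarith)
      have h2 : R ^ (1 - ρ) * R ^ (ρ - 1) = 1 := by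
        rw [← Real.rpow_add hR0]
        have e0 : (1 - ρ) + (ρ - 1) = 0 := by ring
        rw [e0, Real.rpow_zero]
      calc (1 : ℝ) = R ^ (1 - ρ) * R ^ (ρ - 1) := h2.symm
        _ ≤ R ^ (1 - ρ) * ‖z‖ ^ (ρ - 1) := mul_le_mul_of_nonneg_left h1 (Real.rpow_nonneg hR0.le _)
    calc g z ^ 2 = 1 * g z ^ 2 := (one_mul _).symm
      _ ≤ ENNReal.ofReal (R ^ (1 - ρ) * ‖z‖ ^ (ρ - 1)) * g z ^ 2 := by
          gcongr
          rw [← ENNReal.ofReal_one]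
          exact ENNReal.ofReal_le_ofReal hw
      _ = ENNReal.ofReal (R ^ (1 - ρ)) * (g z ^ 2 * ENNReal.ofReal (‖z‖ ^ (ρ - 1))) := by
          rw [ENNReal.ofReal_mul (Real.rpow_nonneg hR0.le _)]
          ring
  calc ∫⁻ z in closedBall (0 : EuclideanSpace ℝ (Fin 3)) R, g z ^ 2
      ≤ ∫⁻ z in closedBall (0 : EuclideanSpace ℝ (Fin 3)) R,
          ENNReal.ofReal (R ^ (1 - ρ)) * (g z ^ 2 * ENNReal.ofReal (‖z‖ ^ (ρ - 1))) := lintegral_mono_ae hae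
    _ = ENNReal.ofReal (R ^ (1 - ρ)) *
          ∫⁻ z in closedBall (0 : EuclideanSpace ℝ (Fin 3)) R, g z ^ 2 * ENNReal.ofReal (‖z‖ ^ (ρ - 1)) :=
        lintegral_const_mul' _ _ ENNReal.ofReal_ne_top
    _ ≤ ENNReal.ofReal (R ^ (1 - ρ)) * ∫⁻ z, g z ^ 2 * ENNReal.ofReal (‖z‖ ^ (ρ - 1)) := by
        exact mul_le_mul_right (setLIntegral_le_lintegral _ _) _

/-- **Cauchy–Schwarz on a set**: `∫_s g ≤ |s|^{1/2} (∫_s g²)^{1/2}`. [folklore] -/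
theorem setLIntegral_le_sqrt_measure_mul_sqrt {s : Set (EuclideanSpace ℝ (Fin 3))}
    {g : EuclideanSpace ℝ (Fin 3) → ℝ≥0∞} (hg : AEMeasurable g (volume.restrict s)) :
    ∫⁻ z in s, g z ≤ volume s ^ (1 / 2 : ℝ) * (∫⁻ z in s, g z ^ 2) ^ (1 / 2 : ℝ) := by
  have h := ENNReal.lintegral_mul_le_Lp_mul_Lq (volume.restrict s) Real.HolderConjugate.two_two
    (f := fun _ => (1 : ℝ≥0∞)) aemeasurable_const hg
  have e2 : ∀ x : ℝ≥0∞, x ^ (2 : ℝ) = x ^ 2 := fun x => by exact_mod_cast ENNReal.rpow_natCast x 2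
  simp only [Pi.mul_apply, one_mul, lintegral_const, Measure.restrict_apply_univ, e2, one_pow] at h
  exact h

/-! ### Exponent bookkeeping and the time integral -/

/-- **The exponent identity `γ(1 + ρ/2) = ½` at work**: `e^{−3γσ} (CL e^{γσ})^{(4−ρ)/2} = (CL)^{(4−ρ)/2} e^{−σ/2}`,
`γ = 1/(2+ρ)`. [folklore] -/
theorem strain_bookkeeping {ρ C L σ : ℝ} (h2ρ : 0 < 2 + ρ) (hCL : 0 ≤ C * L) :
    Real.exp (-(3 * (1 / (2 + ρ)) * σ)) * (C * L * Real.exp (σ / (2 + ρ))) ^ ((4 - ρ) / 2) =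
      (C * L) ^ ((4 - ρ) / 2) * Real.exp (-(σ / 2)) := by
  rw [Real.mul_rpow hCL (Real.exp_pos _).le, ← Real.exp_mul]
  have e : -(3 * (1 / (2 + ρ)) * σ) + σ / (2 + ρ) * ((4 - ρ) / 2) = -(σ / 2) := by
    field_simp
    ring
  calc Real.exp (-(3 * (1 / (2 + ρ)) * σ)) * ((C * L) ^ ((4 - ρ) / 2) * Real.exp (σ / (2 + ρ) * ((4 - ρ) / 2)))
      = (C * L) ^ ((4 - ρ) / 2) * (Real.exp (-(3 * (1 / (2 + ρ)) * σ)) * Real.exp (σ / (2 + ρ) * ((4 - ρ) / 2))) := by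
        ring
    _ = (C * L) ^ ((4 - ρ) / 2) * Real.exp (-(σ / 2)) := by rw [← Real.exp_add, e]

/-- `∫_{[0,S]} e^{−σ/2} dσ ≤ 2` (`S ≥ 0`), in `ℝ≥0∞`. [folklore] -/
theorem lintegral_exp_neg_half_Icc_le {S : ℝ} (hS : 0 ≤ S) :
    ∫⁻ σ in Icc 0 S, ENNReal.ofReal (Real.exp (-(σ / 2))) ≤ ENNReal.ofReal 2 := by
  have hc : Continuous fun σ : ℝ => Real.exp (-(σ / 2)) := by fun_prop
  have hint : IntegrableOn (fun σ : ℝ => Real.exp (-(σ / 2))) (Icc 0 S) volume :=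
    hc.continuousOn.integrableOn_compact isCompact_Icc
  rw [← ofReal_integral_eq_lintegral_ofReal hint (ae_of_all _ fun σ => (Real.exp_pos _).le)]
  refine ENNReal.ofReal_le_ofReal ?_
  rw [integral_Icc_eq_integral_Ioc, ← intervalIntegral.integral_of_le hS]
  have hderiv : ∀ x ∈ uIcc 0 S, HasDerivAt (fun σ : ℝ => -2 * Real.exp (-(σ / 2))) (Real.exp (-(x / 2))) x := by
    intro x _
    have h1 : HasDerivAt (fun σ : ℝ => -(σ / 2)) (-(1 / 2 : ℝ)) x := by
      have h := ((hasDerivAt_id' x).div_const (2 : ℝ)).const_mul (-1)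
      refine (h.congr_of_eventuallyEq (Eventually.of_forall fun σ => ?_)).congr_deriv ?_
      · show -(σ / 2) = -1 * (σ / 2)
        ring
      · ring
    have h2 := h1.exp.const_mul (-2)
    refine h2.congr_deriv ?_
    ring
  rw [intervalIntegral.integral_eq_sub_of_hasDerivAt hderiv (hc.intervalIntegrable 0 S)]
  simp only [neg_zero, zero_div, Real.exp_zero, mul_one]
  have hpos : 0 < Real.exp (-(S / 2)) := Real.exp_pos _
  linarith

end Summit.NavierStokesRegularity.NavierStokesRegularity.Theorems.PowerGaugeEulerLiouville.Trace
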